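import Summits.ResolutionOfSingularities.ResolutionOfSingularities.Theorems.PurelyInseparableDim4GameDeterminacy
import Summits.ResolutionOfSingularities.ResolutionOfSingularities.Theorems.PurelyInseparableDim4TrapBaseChange
import Summits.ResolutionOfSingularities.ResolutionOfSingularities.Theorems.PurelyInseparableDim4Equivariance
import HarnessLib
import HarnessLib.Audit.Tags

/-!
# Purely inseparable fourfolds — ESCAPABLE is `S₄`-invariant and DESCENDS along field maps
# [OURS · counted 0 · statements about OUR frame (`PurelyInseparableDim4Rules`), not about resolution]

Census cell «res-dim4-pi» (D-0157 DOOR 2), width seat `res-dim4-p-14`, brick PR-12k; bookkeeping for the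
trap census' ESCAPABLE / TRAP dichotomy (`StateWins` of `PurelyInseparableDim4GameDeterminacy`):

* **`stateWins_rename_iff`** — ESCAPABLE is invariant under renaming the four variables (induction on
  the attractor through p-6's equivariance `Equivariance.edge_rename` / `isPermissibleCentre_rename_iff`),
  so the census may classify `S₄`-orbits;
* **`stateWins_of_stateWins_map`** — ESCAPABLE DESCENDS along a homomorphism of fields `k →+* K`
  (player B has fewer answers over the smaller field; `BaseChange.edge_map`), the counterpart of
  «traps go up» (`BaseChange.isTrap_image`): an A-WIN found with `K`-rational answers is an A-WIN over
  every subfield the state is defined over — and NOT conversely (more answers for B in extensions).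

DEF-FREE.  Nothing here proves resolution of singularities in dimension ≥ 4 / characteristic `p`;
counted 0; AI work, weaker than expert review.
bears_on: LADDER-RESOLUTION:D157-DOOR2 (res-dim4-pi · PR-12k). Supports stmt-ResolutionOfSingularities-16155
(helper).
-/

set_option linter.dupNamespace false

noncomputable section

namespace Summit.ResolutionOfSingularities.ResolutionOfSingularities.Theorems.PIDim4

namespace EscapableInvariance

open Literature.AlgebraicGeometry.Resolution

/-! ## 1. `S₄`-invariance -/

section Rename

variable {K : Type} [Field K] [DecidableEq K] (q : ℕ)

/-- ESCAPABLE states rename to ESCAPABLE states. [folklore] -/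
theorem stateWins_rename (e : Equiv.Perm (Fin 4)) {s : State K} (h : StateWins q s) :
    StateWins q (s.rename e) := by
  unfold StateWins at h ⊢
  induction h with
  | @terminal s hs =>
    refine Game.Wins.terminal fun S hS => hs (S.map e.symm.toEmbedding) ?_
    rw [← Equivariance.isPermissibleCentre_rename_iff e, Equivariance.map_symm_map]
    exact hS
  | @move s S hS _ ih =>
    refine Game.Wins.move (m := S.map e.toEmbedding)
      ((Equivariance.isPermissibleCentre_rename_iff e q S s.F).mpr hS) fun t' ht' => ?_
    have hback := Equivariance.edge_rename e.symm ht'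
    rw [Equivariance.rename_rename_symm] at hback
    have hS' : (S.map e.toEmbedding).map e.symm.toEmbedding = S := by
      have h1 := Equivariance.map_symm_map e.symm S
      rwa [Equiv.symm_symm] at h1
    rw [hS'] at hback
    have hw := ih (t'.rename e.symm) hback
    have ht : (t'.rename e.symm).rename e = t' := by
      have h2 := Equivariance.rename_rename_symm e.symm t'
      rwa [Equiv.symm_symm] at h2
    rwa [ht] at hw

/-- **ESCAPABLE is `S₄`-invariant.** [folklore] -/
theorem stateWins_rename_iff (e : Equiv.Perm (Fin 4)) (s : State K) :
    StateWins q (s.rename e) ↔ StateWins q s := by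
  refine ⟨fun h => ?_, stateWins_rename q e⟩
  have h' := stateWins_rename q e.symm h
  rwa [Equivariance.rename_rename_symm] at h'

end Rename

/-! ## 2. Descent along field maps -/

section Descent

variable {k K : Type} [Field k] [Field K] [DecidableEq k] [DecidableEq K] (f : k →+* K) (q : ℕ)

/-- **ESCAPABLE descends**: if the extended state `s♯ = (F ⊗ K, r, exc)` is escapable over `K`, then
`s` is escapable over `k` (B's `k`-rational answers are among its `K`-rational ones). [folklore] -/
theorem stateWins_of_stateWins_map {s : State k}
    (h : StateWins q (⟨MvPolynomial.map f s.F, s.r, s.exc⟩ : State K)) : StateWins q s := by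
  unfold StateWins at h ⊢
  generalize hx : (⟨MvPolynomial.map f s.F, s.r, s.exc⟩ : State K) = x at h
  induction h generalizing s with
  | @terminal x hx' =>
    subst hx
    exact Game.Wins.terminal fun S hS =>
      hx' S ((BaseChange.isPermissibleCentre_map_iff f q S s.F).mpr hS)
  | @move x S hS _ ih =>
    subst hx
    exact Game.Wins.move (m := S) ((BaseChange.isPermissibleCentre_map_iff f q S s.F).mp hS)
      fun t ht => ih _ (BaseChange.edge_map f ht) rfl

/-- Contrapositive: a NON-escapable state stays non-escapable in every extension. [folklore] -/
theorem not_stateWins_map_of_not_stateWins {s : State k} (h : ¬ StateWins q s) :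
    ¬ StateWins q (⟨MvPolynomial.map f s.F, s.r, s.exc⟩ : State K) :=
  fun h' => h (stateWins_of_stateWins_map f q h')

end Descent

end EscapableInvariance

end Summit.ResolutionOfSingularities.ResolutionOfSingularities.Theorems.PIDim4

end
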